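import Summits.ResolutionOfSingularities.ResolutionOfSingularities.Theorems.WeightedInvariantIota3EpsUpperSemicontinuous
import HarnessLib

/-!
# Generization-closed indicator letters: «some generization of the position has property `P`» — the dictionary
# `Spec 𝒪_{Y,y} ↔ generizations of y`, (c7) for free, and (c8) from FINITENESS of the `P`-points — door
# `HypersurfaceCentreConstruction` (stmt-ResolutionOfSingularities-19897), route `WeightedInvariant`, rung P3

[OURS · L1 W4.3 · cell `res-hironaka`, HUMAN RULING D-0089] Helper file `--supports stmt-ResolutionOfSingularities-19897`
(res-type-047; scheme-side plumbing for the clause (c8) of indicator letters of the shape ruled for the P3 letter `τ`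
«tie bit» after the DESIGN NOTES of res-type-013 (HOME/STATUS 2026-08-27T12:23:01Z, repair (B): `iotaTau S f := 1` iff
SOME GENERIZATION `(S_𝔭, f/1)` is a tie position) and res-type-047 (12:23:59Z): a letter defined POINTWISE by a
dimension-sensitive predicate (`ringKrullDim S = 3`) violates the unrestricted clauses (c7)/(c8) of `PRung 3` by trivial
thickening; the generization-closed indicator does not).  PARAMETRIC in the predicate `P` — nothing here depends on the
tie predicate; CANDIDATE DESIGN OBJECTS ONLY; nothing here is a statement of the manuscript under review (Hironaka 2017,
[claim: Hironaka2017, status: under-review]); nothing here claims anything about resolution of singularities.  AI work,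
weaker than expert review.

## What is proved (def-free; `P : (R : Type) → [CommRing R] → R → Prop` invariant under ring isomorphisms)

* §1 `exists_generization_iff_exists_specializes` — THE DICTIONARY: for a point `y` of a scheme `Y` and a global
  function `f`, «some prime `𝔭` of `𝒪_{Y,y}` has `P ((𝒪_{Y,y})_𝔭, f_y/1)`» iff «some point `z ⤳ y` (a generization of
  `y`) has `P (𝒪_{Y,z}, f_z)`» (affine chart `U ∋ y`: primes of `𝒪_{Y,y} = Γ(Y,U)_{𝔭_y}` are the primes `q ≤ 𝔭_y` of
  `Γ(Y,U)`, `(𝒪_{Y,y})_𝔭 ≃ Γ(Y,U)_q ≃ 𝒪_{Y, fromSpec q}` over `Γ(Y,U)`; `q ≤ 𝔭_y` iff `fromSpec q ⤳ y`).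
* §2 `setOf_exists_generization_eq_biUnion_closure` — the locus «some generization has `P`» is the union of the
  closures of the `P`-points; `isClosed_setOf_exists_generization_of_finite` — it is CLOSED as soon as the set of
  `P`-points is finite (on a quasi-compact ambient: as soon as it is locally finite).
* §3 `indicator_upperSemicontinuous_of_finite` — for any class function `ι` with values in `{0, 1}` and
  `ι S f = 1 ↔ ∃ 𝔭, P (S_𝔭) (f/1)`: **(c8) `IotaUpperSemicontinuous ι` follows from the finiteness of the `P`-points on
  every smooth quasi-compact `Y` over a field** (the thresholds `α = 0` / `α > 1` are trivial); hence also the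
  stratum-relative `IotaUpperSemicontinuousOn ι₁ ι` for every first key (`iotaUpperSemicontinuousOn_of`).
  §3 `indicator_generizationMonotone` — (c7) `IotaGenerizationMonotone ι` for such `ι`, for free
  (`(S_𝔮)_𝔭' ≃ S_{𝔭' ∩ S}`).

For the tie bit this reduces (c8τ) to ONE mathematical statement: «on a smooth quasi-compact `Y` over a field the set of
points `y` with `IsTiePosition 𝒪_{Y,y} f_y` is finite» (IOTA3-DESIGN v1.3 §8.5 (c8τ): lex-maximality at `S_{P₀}` forbids a
tie at the generic presentation, so the tie points of each stratum curve are finitely many).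

## References

* res-L1-w43-plan-1, `L/res-L1-w43-plan-1/IOTA3-DESIGN.md` v1.3 §8.5 (OURS, AI planning); res-type-013 / res-type-047
  design notes HOME/STATUS 2026-08-27T12:23Z.
-/

noncomputable section

set_option linter.dupNamespace false -- mandated namespace `Summit.<Summit>.<Problem>` of this single-conjunct summit

open CategoryTheory AlgebraicGeometry TopologicalSpace IsLocalRing Topology
open Literature.AlgebraicGeometry.Resolution

namespace Summit.ResolutionOfSingularities.ResolutionOfSingularities.Cruxes.HypersurfaceCentreConstruction.LocalEngine

namespace GenerizationClosed

variable (P : (R : Type) → [CommRing R] → R → Prop)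

/-! ## §1 The dictionary: primes of `𝒪_{Y,y}` ↔ generizations of `y` -/

section Dictionary

variable {Y : Scheme.{0}} (U : Y.affineOpens)

/-- The germ of a global section at a point of the chart is `f|_U / 1` for the section algebra structure. [folklore] -/
theorem germ_top_eq_algebraMap (f : Γ(Y, ⊤)) {z : Y} (hz : z ∈ (U : Y.Opens)) :
    letI := TopCat.Presheaf.algebra_section_stalk Y.presheaf (⟨z, hz⟩ : (U : Y.Opens))
    (Y.presheaf.germ ⊤ z trivial) f = algebraMap Γ(Y, U) (Y.presheaf.stalk z) (Y.presheaf.map (homOfLE le_top).op f) :=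
  (TopCat.Presheaf.germ_res_apply Y.presheaf (homOfLE le_top) z hz f).symm

/-- `q ≤ 𝔭_y` iff `fromSpec q ⤳ y` (points of the chart). [folklore] -/
theorem le_primeIdealOf_iff_specializes {y : Y} (hy : y ∈ (U : Y.Opens)) (q : PrimeSpectrum Γ(Y, U)) :
    q.asIdeal ≤ (U.2.primeIdealOf ⟨y, hy⟩).asIdeal ↔ U.2.fromSpec q ⤳ y := by
  constructor
  · intro h
    have h1 : q ⤳ U.2.primeIdealOf ⟨y, hy⟩ := (PrimeSpectrum.le_iff_specializes _ _).mp h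
    have h2 := h1.map U.2.fromSpec.continuous
    rwa [IsAffineOpen.fromSpec_primeIdealOf] at h2
  · intro h
    have h1 := primeIdealOf_le_of_specializes U hy (Iota3.fromSpec_mem U q) h
    rwa [Iota3.primeIdealOf_fromSpec U q (Iota3.fromSpec_mem U q)] at h1

variable (hP : ∀ (R T : Type) [CommRing R] [CommRing T] (e : R ≃+* T) (g : R), P R g ↔ P T (e g))
include hP

/-- **Transport along `(𝒪_{Y,y})_𝔭 ≃ 𝒪_{Y,z}`**: for `y ∈ U`, a prime `𝔭` of `𝒪_{Y,y}` contracting to `q ≤ 𝔭_y` in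
`Γ(Y,U)`, and a point `z ∈ U` whose stalk is a localization of `Γ(Y,U)` at `q` (for the section algebra structure),
`P ((𝒪_{Y,y})_𝔭, f_y/1) ↔ P (𝒪_{Y,z}, f_z)`. [folklore] -/
theorem localization_stalk_iff (f : Γ(Y, ⊤)) {y : Y} (hy : y ∈ (U : Y.Opens))
    (𝔭 : PrimeSpectrum (Y.presheaf.stalk y)) {z : Y} (hz : z ∈ (U : Y.Opens))
    (hloc : letI := TopCat.Presheaf.algebra_section_stalk Y.presheaf (⟨z, hz⟩ : (U : Y.Opens))
      letI := TopCat.Presheaf.algebra_section_stalk Y.presheaf (⟨y, hy⟩ : (U : Y.Opens))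
      IsLocalization (𝔭.asIdeal.comap (algebraMap Γ(Y, U) (Y.presheaf.stalk y))).primeCompl (Y.presheaf.stalk z)) :
    P (Localization.AtPrime 𝔭.asIdeal)
        (algebraMap (Y.presheaf.stalk y) (Localization.AtPrime 𝔭.asIdeal) ((Y.presheaf.germ ⊤ y trivial) f)) ↔
      P (Y.presheaf.stalk z) ((Y.presheaf.germ ⊤ z trivial) f) := by
  letI algz := TopCat.Presheaf.algebra_section_stalk Y.presheaf (⟨z, hz⟩ : (U : Y.Opens))
  letI algy := TopCat.Presheaf.algebra_section_stalk Y.presheaf (⟨y, hy⟩ : (U : Y.Opens))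
  haveI : IsLocalization.AtPrime (Y.presheaf.stalk y) (U.2.primeIdealOf ⟨y, hy⟩).asIdeal :=
    U.2.isLocalization_stalk ⟨y, hy⟩
  -- `(𝒪_{Y,y})_𝔭` is a localization of `Γ(Y,U)` at `q = 𝔭 ∩ Γ(Y,U)`
  haveI : IsLocalization (𝔭.asIdeal.comap (algebraMap Γ(Y, U) (Y.presheaf.stalk y))).primeCompl
      (Localization.AtPrime 𝔭.asIdeal) :=
    IsLocalization.isLocalization_isLocalization_atPrime_isLocalization
      (U.2.primeIdealOf ⟨y, hy⟩).asIdeal.primeCompl (Localization.AtPrime 𝔭.asIdeal) 𝔭.asIdeal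
  haveI := hloc
  let e : Localization.AtPrime 𝔭.asIdeal ≃ₐ[Γ(Y, U)] Y.presheaf.stalk z :=
    IsLocalization.algEquiv (𝔭.asIdeal.comap (algebraMap Γ(Y, U) (Y.presheaf.stalk y))).primeCompl _ _
  have hfy : algebraMap (Y.presheaf.stalk y) (Localization.AtPrime 𝔭.asIdeal) ((Y.presheaf.germ ⊤ y trivial) f) =
      algebraMap Γ(Y, U) (Localization.AtPrime 𝔭.asIdeal) (Y.presheaf.map (homOfLE le_top).op f) := by
    rw [germ_top_eq_algebraMap U f hy, ← IsScalarTower.algebraMap_apply]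
  have hfz : e (algebraMap Γ(Y, U) (Localization.AtPrime 𝔭.asIdeal) (Y.presheaf.map (homOfLE le_top).op f)) =
      (Y.presheaf.germ ⊤ z trivial) f := by
    rw [AlgEquiv.commutes, germ_top_eq_algebraMap U f hz]
  rw [hfy, hP _ _ e.toRingEquiv, ← hfz]
  rfl

/-- **THE DICTIONARY.**  For a point `y` of a scheme `Y` and `f ∈ Γ(Y, 𝒪_Y)`: some prime `𝔭` of `𝒪_{Y,y}` has
`P ((𝒪_{Y,y})_𝔭, f_y/1)` iff some generization `z ⤳ y` has `P (𝒪_{Y,z}, f_z)`. [OURS] -/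
theorem exists_generization_iff_exists_specializes (f : Γ(Y, ⊤)) {y : Y} (hy : y ∈ (U : Y.Opens)) :
    (∃ 𝔭 : PrimeSpectrum (Y.presheaf.stalk y),
        P (Localization.AtPrime 𝔭.asIdeal)
          (algebraMap (Y.presheaf.stalk y) (Localization.AtPrime 𝔭.asIdeal) ((Y.presheaf.germ ⊤ y trivial) f))) ↔
      ∃ z : Y, z ⤳ y ∧ P (Y.presheaf.stalk z) ((Y.presheaf.germ ⊤ z trivial) f) := by
  letI algy := TopCat.Presheaf.algebra_section_stalk Y.presheaf (⟨y, hy⟩ : (U : Y.Opens))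
  haveI hlocy : IsLocalization.AtPrime (Y.presheaf.stalk y) (U.2.primeIdealOf ⟨y, hy⟩).asIdeal :=
    U.2.isLocalization_stalk ⟨y, hy⟩
  constructor
  · rintro ⟨𝔭, h𝔭⟩
    -- `q = 𝔭 ∩ Γ(Y,U) ≤ 𝔭_y`, `z = fromSpec q ⤳ y`
    set q : PrimeSpectrum Γ(Y, U) := ⟨𝔭.asIdeal.comap (algebraMap Γ(Y, U) (Y.presheaf.stalk y)), inferInstance⟩
      with hq
    have hqle : q.asIdeal ≤ (U.2.primeIdealOf ⟨y, hy⟩).asIdeal :=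
      Iota3.comap_le_of_isLocalization_atPrime (U.2.primeIdealOf ⟨y, hy⟩).asIdeal (Y.presheaf.stalk y) 𝔭.asIdeal
    refine ⟨U.2.fromSpec q, (le_primeIdealOf_iff_specializes U hy q).mp hqle, ?_⟩
    have hloc := U.2.isLocalization_stalk' q (Iota3.fromSpec_mem U q)
    exact (localization_stalk_iff P U hP f hy 𝔭 (Iota3.fromSpec_mem U q) hloc).mp h𝔭
  · rintro ⟨z, hzy, hz⟩
    have hzU : z ∈ (U : Y.Opens) := hzy.mem_open U.1.isOpen hy
    letI algz := TopCat.Presheaf.algebra_section_stalk Y.presheaf (⟨z, hzU⟩ : (U : Y.Opens))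
    haveI hlocz : IsLocalization.AtPrime (Y.presheaf.stalk z) (U.2.primeIdealOf ⟨z, hzU⟩).asIdeal :=
      U.2.isLocalization_stalk ⟨z, hzU⟩
    -- the prime `𝔭 = 𝔮_z · 𝒪_{Y,y}` of `𝒪_{Y,y}`
    have hle := primeIdealOf_le_of_specializes U hy hzU hzy
    have hdisj : Disjoint ((U.2.primeIdealOf ⟨y, hy⟩).asIdeal.primeCompl : Set Γ(Y, U))
        ((U.2.primeIdealOf ⟨z, hzU⟩).asIdeal : Set Γ(Y, U)) := by
      rw [Set.disjoint_left]
      intro a ha ha'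
      exact ha (hle ha')
    set 𝔓 : Ideal (Y.presheaf.stalk y) :=
      (U.2.primeIdealOf ⟨z, hzU⟩).asIdeal.map (algebraMap Γ(Y, U) (Y.presheaf.stalk y)) with h𝔓
    haveI h𝔓p : 𝔓.IsPrime :=
      IsLocalization.isPrime_of_isPrime_disjoint (U.2.primeIdealOf ⟨y, hy⟩).asIdeal.primeCompl _ _ inferInstance hdisj
    have hcomap : 𝔓.comap (algebraMap Γ(Y, U) (Y.presheaf.stalk y)) = (U.2.primeIdealOf ⟨z, hzU⟩).asIdeal :=
      IsLocalization.under_map_of_isPrime_disjoint _ _ inferInstance hdisj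
    refine ⟨⟨𝔓, h𝔓p⟩, ?_⟩
    have hM : (𝔓.comap (algebraMap Γ(Y, U) (Y.presheaf.stalk y))).primeCompl =
        (U.2.primeIdealOf ⟨z, hzU⟩).asIdeal.primeCompl := by
      ext a; simp only [Ideal.mem_primeCompl_iff, hcomap]
    have hloc : IsLocalization (𝔓.comap (algebraMap Γ(Y, U) (Y.presheaf.stalk y))).primeCompl (Y.presheaf.stalk z) := by
      rw [hM]
      exact hlocz
    exact (localization_stalk_iff P U hP f hy ⟨𝔓, h𝔓p⟩ hzU hloc).mpr hz

end Dictionary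

/-! ## §2 The locus «some generization has `P`» and its closedness -/

section Locus

variable {Y : Scheme.{0}}
variable (hP : ∀ (R T : Type) [CommRing R] [CommRing T] (e : R ≃+* T) (g : R), P R g ↔ P T (e g))
include hP

/-- **The locus «some generization has `P`» is the union of the closures of the `P`-points.** [OURS] -/
theorem setOf_exists_generization_eq_biUnion_closure (f : Γ(Y, ⊤)) :
    {y : Y | ∃ 𝔭 : PrimeSpectrum (Y.presheaf.stalk y),
        P (Localization.AtPrime 𝔭.asIdeal)
          (algebraMap (Y.presheaf.stalk y) (Localization.AtPrime 𝔭.asIdeal) ((Y.presheaf.germ ⊤ y trivial) f))} =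
      ⋃ z ∈ {z : Y | P (Y.presheaf.stalk z) ((Y.presheaf.germ ⊤ z trivial) f)}, closure {z} := by
  ext y
  -- an affine chart through `y`
  have hytop : y ∈ (⊤ : Y.Opens) := trivial
  rw [← iSup_affineOpens_eq_top Y] at hytop
  obtain ⟨U, hy⟩ := Opens.mem_iSup.mp hytop
  rw [Set.mem_setOf_eq, exists_generization_iff_exists_specializes P U hP f hy]
  simp only [Set.mem_iUnion, Set.mem_setOf_eq, exists_prop, specializes_iff_mem_closure]
  exact ⟨fun ⟨z, hzy, hz⟩ => ⟨z, hz, hzy⟩, fun ⟨z, hz, hzy⟩ => ⟨z, hzy, hz⟩⟩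

/-- **Closedness from finiteness**: if the `P`-points of `(Y, f)` are finitely many, the locus «some generization has
`P`» is closed. [OURS] -/
theorem isClosed_setOf_exists_generization_of_finite (f : Γ(Y, ⊤))
    (hfin : {z : Y | P (Y.presheaf.stalk z) ((Y.presheaf.germ ⊤ z trivial) f)}.Finite) :
    IsClosed {y : Y | ∃ 𝔭 : PrimeSpectrum (Y.presheaf.stalk y),
        P (Localization.AtPrime 𝔭.asIdeal)
          (algebraMap (Y.presheaf.stalk y) (Localization.AtPrime 𝔭.asIdeal) ((Y.presheaf.germ ⊤ y trivial) f))} := by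
  rw [setOf_exists_generization_eq_biUnion_closure P hP f]
  exact hfin.isClosed_biUnion fun _ _ => isClosed_closure

omit hP in
/-- On a quasi-compact space a locally finite set is finite (the form in which a chart-wise finiteness of the
`P`-points is used). [folklore] -/
theorem finite_of_locally_finite [CompactSpace Y] {T : Set Y}
    (hloc : ∀ y : Y, ∃ V : Set Y, IsOpen V ∧ y ∈ V ∧ (T ∩ V).Finite) : T.Finite := by
  choose V hVo hyV hfin using hloc
  obtain ⟨s, hs⟩ := isCompact_univ.elim_finite_subcover V hVo (fun y _ => Set.mem_iUnion.mpr ⟨y, hyV y⟩)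
  have hT : T ⊆ ⋃ y ∈ s, T ∩ V y := by
    intro t ht
    obtain ⟨y, hy⟩ := Set.mem_iUnion.mp (hs (Set.mem_univ t))
    obtain ⟨hys, hty⟩ := Set.mem_iUnion.mp hy
    exact Set.mem_biUnion hys ⟨ht, hty⟩
  exact (s.finite_toSet.biUnion fun y _ => hfin y).subset hT

end Locus

/-! ## §3 Indicator letters: (c7) for free, (c8) from finiteness -/

section Indicator

variable (ι : (R : Type) → [CommRing R] → R → Ordinal.{0})
  (h01 : ∀ (S : Type) [CommRing S] (g : S), ι S g = 0 ∨ ι S g = 1)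
  (h1 : ∀ (S : Type) [CommRing S] (g : S), ι S g = 1 ↔
    ∃ 𝔭 : PrimeSpectrum S, P (Localization.AtPrime 𝔭.asIdeal) (algebraMap S (Localization.AtPrime 𝔭.asIdeal) g))
  (hP : ∀ (R T : Type) [CommRing R] [CommRing T] (e : R ≃+* T) (g : R), P R g ↔ P T (e g))
include h01 h1 hP

/-- **(c7) for free**: a generization-closed indicator does not increase under localization at a prime (a
generization of a generization is a generization: `(S_𝔮)_𝔭' ≃ S_{𝔭' ∩ S}`). [OURS] -/
theorem indicator_generizationMonotone : IotaGenerizationMonotone ι := by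
  intro S _ _ 𝔮 _ g
  rcases h01 (Localization.AtPrime 𝔮) (algebraMap S _ g) with h | h
  · rw [h]; exact zero_le
  · obtain ⟨𝔭', h𝔭'⟩ := (h1 _ _).mp h
    -- `(S_𝔮)_𝔭'` is a localization of `S` at `𝔭 = 𝔭' ∩ S`
    set 𝔭 : Ideal S := 𝔭'.asIdeal.comap (algebraMap S (Localization.AtPrime 𝔮)) with h𝔭
    haveI : IsLocalization 𝔭.primeCompl (Localization.AtPrime 𝔭'.asIdeal) :=
      IsLocalization.isLocalization_isLocalization_atPrime_isLocalization 𝔮.primeCompl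
        (Localization.AtPrime 𝔭'.asIdeal) 𝔭'.asIdeal
    let e : Localization.AtPrime 𝔭 ≃ₐ[S] Localization.AtPrime 𝔭'.asIdeal :=
      IsLocalization.algEquiv 𝔭.primeCompl _ _
    have hg : e (algebraMap S (Localization.AtPrime 𝔭) g) =
        algebraMap (Localization.AtPrime 𝔮) (Localization.AtPrime 𝔭'.asIdeal) (algebraMap S _ g) := by
      rw [AlgEquiv.commutes, IsScalarTower.algebraMap_apply S (Localization.AtPrime 𝔮)]
    have hS : ι S g = 1 := (h1 S g).mpr ⟨⟨𝔭, inferInstance⟩, (hP _ _ e.toRingEquiv _).mpr (by rw [← hg] at h𝔭'; exact h𝔭')⟩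
    rw [h, hS]

/-- **(c8) from finiteness of the `P`-points.**  If on every smooth quasi-compact scheme `Y` over a field and for
every `f ∈ Γ(Y, 𝒪_Y)` the set `{z | P (𝒪_{Y,z}, f_z)}` is finite, then the generization-closed indicator `ι`
(`ι = 1` iff some generization of the position has `P`) is upper semicontinuous: `{1 ≤ ι}` is the finite union of the
closures of the `P`-points, `{0 ≤ ι} = Y`, `{α ≤ ι} = ∅` for `α > 1`. [OURS] -/
theorem indicator_upperSemicontinuous
    (hfin : ∀ (k₀ : Type) [Field k₀] (Y : Scheme.{0}) (hY : Y ⟶ Spec (CommRingCat.of k₀)) [Smooth hY]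
      [QuasiCompact hY] (f : Γ(Y, ⊤)), {z : Y | P (Y.presheaf.stalk z) ((Y.presheaf.germ ⊤ z trivial) f)}.Finite) :
    IotaUpperSemicontinuous ι := by
  intro k₀ _ Y hY _ _ f α
  rcases eq_or_ne α 0 with rfl | hα0
  · have : {y : Y | (0 : Ordinal) ≤ ι (Y.presheaf.stalk y) ((Y.presheaf.germ ⊤ y trivial) f)} = Set.univ := by
      ext y; simp
    rw [this]; exact isClosed_univ
  by_cases hα1 : α ≤ 1
  · -- `{α ≤ ι} = {ι = 1}` = the locus «some generization has P»
    have hset : {y : Y | α ≤ ι (Y.presheaf.stalk y) ((Y.presheaf.germ ⊤ y trivial) f)} =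
        {y : Y | ∃ 𝔭 : PrimeSpectrum (Y.presheaf.stalk y),
          P (Localization.AtPrime 𝔭.asIdeal)
            (algebraMap (Y.presheaf.stalk y) (Localization.AtPrime 𝔭.asIdeal) ((Y.presheaf.germ ⊤ y trivial) f))} := by
      ext y
      rw [Set.mem_setOf_eq, Set.mem_setOf_eq, ← h1]
      rcases h01 (Y.presheaf.stalk y) ((Y.presheaf.germ ⊤ y trivial) f) with h | h <;> rw [h]
      · simp only [nonpos_iff_eq_zero, zero_ne_one, iff_false]
        exact hα0
      · simp only [hα1]
    rw [hset]
    exact isClosed_setOf_exists_generization_of_finite P hP f (hfin k₀ Y hY f)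
  · have : {y : Y | α ≤ ι (Y.presheaf.stalk y) ((Y.presheaf.germ ⊤ y trivial) f)} = ∅ := by
      ext y
      simp only [Set.mem_setOf_eq, Set.mem_empty_iff_false, iff_false]
      intro hα
      apply hα1
      rcases h01 (Y.presheaf.stalk y) ((Y.presheaf.germ ⊤ y trivial) f) with h | h
      · rw [h] at hα; exact hα.trans zero_le_one
      · rw [h] at hα; exact hα
    rw [this]; exact isClosed_empty

/-- The stratum-relative form: (c8) for the indicator along the strata of ANY first key `ι₁`. [OURS] -/
theorem indicator_upperSemicontinuousOn (ι₁ : (R : Type) → [CommRing R] → R → Ordinal.{0})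
    (hfin : ∀ (k₀ : Type) [Field k₀] (Y : Scheme.{0}) (hY : Y ⟶ Spec (CommRingCat.of k₀)) [Smooth hY]
      [QuasiCompact hY] (f : Γ(Y, ⊤)), {z : Y | P (Y.presheaf.stalk z) ((Y.presheaf.germ ⊤ z trivial) f)}.Finite) :
    IotaUpperSemicontinuousOn ι₁ ι :=
  iotaUpperSemicontinuousOn_of (indicator_upperSemicontinuous P ι h01 h1 hP hfin)

end Indicator

end GenerizationClosed

end Summit.ResolutionOfSingularities.ResolutionOfSingularities.Cruxes.HypersurfaceCentreConstruction.LocalEngine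

end
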